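import Literature.MathematicalPhysics.QuantumFieldTheory.Balaban1983to89.B8Prop6DentedCubeMemberNormsGammaRec
import Literature.MathematicalPhysics.QuantumFieldTheory.Balaban1983to89.B8Thm4KLevelGammaRec
import Literature.MathematicalPhysics.QuantumFieldTheory.Balaban1983to89.B8Prop6CubeMemberRec
import Literature.MathematicalPhysics.QuantumFieldTheory.Balaban1983to89.B8Prop6DentedCubeMemberNormsFlatGamma

/-!
# `Balaban1983to89.B8Prop6DentedCubeMemberNormsFlatGammaRec` — RECORD TWIN of `B8Prop6DentedCubeMemberNormsFlatGamma` ([Balaban1985RegularSpaces] PROPOSITION 3 (p. 87) ∕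
# PROPOSITION 6 (1.136) ∕ [Balaban1985Variational] (152) AT THE DENTED CUBE MEMBER, BACKGROUND `1`: THE NORM MEMBERS FROM THE FOUR-LINE FLAT γ SOCKET, edition γ) FOR THE
# SYMMETRISED CENTRED block averaging (0.4) of [Balaban1987RG1], with the RECORD's Prop-4 regime

statement-level skeleton of published theorems with citation tags; proofs where landed; nothing here is a claim about the Yang–Mills mass gap

T. Bałaban, *Spaces of regular gauge field configurations on a lattice and gauge fixing conditions*, Commun. Math. Phys. **99** (1985) 75–102 `[Balaban1985RegularSpaces]`
("[6]"): Prop. 3 p. 87, Prop. 6 (1.136) p. 99, (1.29) p. 81, (1.31) p. 82, (1.40)–(1.42) p. 83, (1.55)–(1.61) p. 86, (1.131)–(1.133) p. 99; T. Bałaban, *Propagators for lattice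
gauge theories in a background field*, Commun. Math. Phys. **99** (1985) 389–434 `[Balaban1985BackgroundPropagators]` ("[4]"): (3.16) p. 393; T. Bałaban, *The variational
problem and background fields in renormalization group method for lattice gauge theories*, Commun. Math. Phys. **102** (1985) 277–309 `[Balaban1985Variational]` ("[15]"):
(148)–(152) p. 301; T. Bałaban, *Renormalization group approach to lattice gauge field theories. I*, Commun. Math. Phys. **109** (1987) 249–301 `[Balaban1987RG1]` ("[I]"):
(0.3)–(0.4) pp. 252–253.  STATUS: published.

CITATION HEADER (lean-in-tree rule).  Cell `pub-ymgap`, «N05-REC» stage 2 (director-ym №254∕№255∕№288), item R6 (the crown road), module (g)-3 of the lead pen's `R6-PLAN.md`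
— typed by the LEAD PEN dag-n05-e g38 on dag-n05-c's recipe (inventory `N05-REC-INVENTORY.md` §R6 row `B8Prop6DentedCubeMemberNormsFlatGamma`: class A =
`norms136_dentedMember_flat_γ_d4`).  WHAT IS REPRODUCED = ✓ the engine theorem, proof verbatim under the token map: the four-line FLAT γ socket binder now carries the RECORD
(1.40) classes, the record Landau form `IsLandau138WZ` and the record averaging datum `|B₁|` = `sup ‖linCovIterZ L 1 (iηA′) j c‖` over the split print class
`c.lamBPT c.k j ∪ {level-0 crossing bonds of Ω′₀}`; the |B₁| slot by the record `B8Thm4KLevelGammaRec.norm_B1_lt_kLevel_γ` ((1.56)-constant `(1+2gZ)·2C₁KZ²·e^{4cZ·L²α₀′}·L²`,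
hence `C₂ ≥ 2(1+2gZ)·2C₁KZ²·L²`) over (1.42)₂ on the class (`B8Prop6DentedCubeMemberNormsGammaRec.c137_dentedMember_γ`), Prop. 3's record windows at `(L²α₀′, L·α₂)`
(`prop3_windowsZ`), the level-`0` crossing terms by the support clause + (1.29)₀ (`mem_lamS_zero_of_not_mem_cube_one`, `margin2_cubeFamZ`, `restr129Z_level_zero`) and (1.133)₀
(`B8Prop6CubeMemberRec.norm_cutFixedZ_sub_one_le`); the token-free analysis ((1.55) `B8Eq155KLevelLocal`, `B8Prop3KLevelBdry.apriori_160_bdry ∕ _162_bdry`, `mlogCfg_spec`)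
unchanged.  TOKEN MAP: `linCovIter ∕ logCovIter ∕ cutFixed ∕ Restr129 ∕ IsLandau138W ↦ …Z`; `(hL : 2 ≤ L) ↦ (hLs : L = 2s+1) (hs : 1 ≤ s)`; `C0 ↦ C0Z`; engine constant
`2097152(d+1)²L² ≤ C₂` ↦ `2(1+2gZ)·2C₁KZ²·L² ≤ C₂`.  Declaration name = engine name (T5).  Kind «kernel-checked proof», theorems only; no `def`, no `instance`, no `notation`,
no existing module modified.  `--supports stmt-QuantumFields-20541` (K0⁷-keyed, COUNT-NEUTRAL).

HONEST SCOPE: Proposition 3's in-edge is a HYPOTHESIS (the flat γ socket binder, discharged downstream by the record (h)-supplier); nothing of [4] Thm 3.3 ∕ [6] Prop. 3 is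
proved here; `HThm4Rec` UNDISCHARGED; caveat (C-S3-1) + addendum v4 stand; N05 [B8] DISCHARGED OF RECORD untouched; N05 ∕ N07 NOT discharged; COUNT of record unmoved · K
numerically unchanged; one finite `𝕋⁴` programme at fixed `ε`, Bałaban AS PRINTED; nothing continuum ∕ ℝ⁴ ∕ OS ∕ mass-gap ∕ Clay.  No `sorry`, no `def`.

[cite: Balaban1985RegularSpaces, Prop. 3 p.87, Prop. 6 (1.136) p.99, (1.29) p.81, (1.31) p.82, (1.40)–(1.42) p.83, (1.55)–(1.61) p.86, (1.133) p.99; Balaban1985BackgroundPropagators, (3.16) p.393; Balaban1985Variational, (148)–(152) p.301; Balaban1987RG1, (0.3)–(0.4) pp.252–253]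
-/

noncomputable section

open NormedSpace

namespace Literature.MathematicalPhysics.QuantumFieldTheory.Balaban1983to89.B8Prop6DentedCubeMemberNormsFlatGammaRec

open MatrixLog B7Prop1Explicit B7Prop2Explicit B7Prop1Local
open B7Eq92Concrete (mgauge mgauge_one_left)
open B7Prop2Explicit (c2' unitaryUnits unitaryUnits_le_U1)
open B7Prop2Rec (AvgClosedZ C0Z avgClosedZ_unitaryUnits)
open B7Prop3Flat (c3)
open B7Prop4GeneralLevelsRec (cZ gZ KZ gZ_nonneg)
open BlockAveragingZd (avgIterZ ctrShift)
open B7SectEFLinearisationRec (logCovIterZ linCovIterZ)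
open B8Ineq130 (gaugeAct_one)
open B8Ineq132 (covDerivFwd InAk inAk_gaugeAct_iff BondTouches)
open B8Ineq133Rec (cutFixedZ)
open B8Lemma1NonAbelian (mulCfg)
open B8Eq115GaugeFixing (gaugeAct_mul gaugeAct_mem_of)
open B8Eq146AExpansion (iEta expCfg plaqCovDeriv)
open B8Eq143PlaqExpansion (pdiv)
open B8Eq184Proof (cfgExp)
open B8Eq140Level (SideTouches)
open B8Eq119TwistedAxialRec (InAxZ Restr129Z restr129Z_level_zero)
open B8Eq155JBound (Jcur wsup)
open B8ScaledSupNorm (bondNorm msup weight Bdd)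
open B8Eq138LandauZd (logCfg covLap)
open B8Eq138LandauZdRec (IsLandau138WZ)
open B8Eq131Cubes (tLo tHi ctr)
open B8Eq131CubesAdmissibleRec (cubeFamZ cubeFam_false_zero)
open B9SupplySockB9P3ZdBeta (CrossB)
open B8Prop6CubeMemberRec (norm_cutFixedZ_sub_one_le)
open B8Prop3GaugeFixedKLevel (inAk_congr_of_sideTouches expCfg_iEta_eq_cfgExp)
open B8LeafModelZd3 (mlogCfg mlogCfg_spec mlogCfg_of_sideTouches)
open B8Prop6DentedCubeMemberNormsGammaRec (prop3_windowsZ c137_dentedMember_γ margin2_cubeFamZ mem_lamS_zero_of_not_mem_cube_one)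
open B8Prop6DentedCubeMemberGammaRec (thm4_hypotheses_one_cutFixed_dented_γ)
open B8DentedCubeMemberZdRec (lamBPT_hbox_pred)
open Node00 (CubeB8DZ)
open B8Thm4KLevelGammaRec (norm_B1_lt_kLevel_γ)

-- `Site` alone could resolve to the torus sites of `Setup.lean`; re-export the `ℤ^d` sites of `B7Prop1Explicit`.
export B7Prop1Explicit (Site)

variable {d : ℕ}

variable {𝔸 : Type*} [CStarAlgebra 𝔸] [Nontrivial 𝔸]

/-! ## §1 Proposition 3 at the dented RECORD member from the FOUR-LINE flat γ socket at the FLAT background -/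
set_option maxHeartbeats 400000 in
/-- (RECORD TWIN of `B8Prop6DentedCubeMemberNormsFlatGamma.norms136_dentedMember_flat_γ_d4`.) ★ **PROPOSITION 3 (p. 87) AT THE DENTED RECORD CUBE MEMBER (`CubeB8DZ`, [15]
(148)–(150)), BACKGROUND `1`: THE NORM MEMBERS OF (1.136) FROM THE FOUR-LINE FLAT γ SOCKET, RECORD AVERAGING** — the socket binder quantified over the configurations `W` at
background `1` ONLY, with the record (1.40) classes, the record Landau form and the record averaging index `|B₁|` over the split print class `c.lamBPT c.k j ∪ {level-0 crossing
bonds of Ω′₀}`; `C₂ ≥ 2(1+2gZ)·2C₁KZ²·L²`; the support clause «`u = 1` off `Ω′₀`», `0 ≤ B_∂`, `4B_∂ ≤ (dL − 1)B₀`; SAME conclusions (`5dLB₀·s`, `s = α₀′ + α₁′`, for the three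
members).  Proof: the engine's with (1.42)₂ on the class from `c137_dentedMember_γ`, the box law `lamBPT_hbox_pred`, the |B₁| slot `norm_B1_lt_kLevel_γ` (record), Prop. 3's
record windows at `(L²α₀′, L·α₂)`; the level-0 crossing terms: `Q₀ = 1`; `u = 1` at both end-points by the support clause and (1.29)₀ on `□₀ ∖ □₁`; `η‖A(b)‖ ≤ 2‖U₀″(b) − 1‖ ≤
2α₁′ ≤ 2dLα₁′` ((1.133)₀, `norm_cutFixedZ_sub_one_le`).  Odd `L = 2s+1`, `s ≥ 1`, `d ≥ 2`.
[cite: Balaban1985RegularSpaces, Prop. 3 p.87, Prop. 6 (1.136) p.99, (1.29) p.81, (1.31) p.82, (1.40)–(1.42) p.83, (1.58)–(1.61) p.86, (1.133) p.99; Balaban1985Variational, (148)–(152) p.301; Balaban1984PropagatorsII, (2.3) p.224; Balaban1987RG1, (0.3)–(0.4) pp.252–253] -/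
theorem norms136_dentedMember_flat_γ_d4 (hd2 : 2 ≤ d) {L s : ℕ} (hLs : L = 2 * s + 1) (hs : 1 ≤ s) {B₀ C₂ cB9 Bbd : ℝ} (hB₀ : 0 < B₀)
    (hC₂ : 2 * ((1 + 2 * gZ d L) * (2 * (131072 * ((d : ℝ) + 1) ^ 2) * (KZ d L) ^ 2)) * (L : ℝ) ^ 2 ≤ C₂) (hcB9 : 0 < cB9) (hBbd : 0 ≤ Bbd)
    (hBd : 4 * Bbd ≤ ((d : ℝ) * L - 1) * B₀) :
    ∃ c₀ : ℝ, 0 < c₀ ∧ ∀ (η : ℝ), 0 < η → ∀ {K : ℕ} {Ω : ℕ → Set (Site d)} (c : CubeB8DZ d L K Ω),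
      -- the Prop.-3-frame b9 socket AT THE MEMBER, AT THE FLAT BACKGROUND ONLY, EDITION β — FOUR LINES, RECORD letters
      (∀ α₀ α₂ : ℝ, 0 < α₀ → α₀ ≤ cB9 → 0 < α₂ → α₂ ≤ cB9 →
      ∀ (W : Site d → Fin d → 𝔸ˣ), (∀ x κ, W x κ ∈ unitaryUnits 𝔸) →
      InAk L c.k η α₀ c.sq (1 : Site d → Fin d → 𝔸ˣ) → InAk L c.k η α₀ c.sq (mulCfg W (1 : Site d → Fin d → 𝔸ˣ)) →
      IsLandau138WZ L c.k η (c.sq 0) c.lamS (1 : Site d → Fin d → 𝔸ˣ) W →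
      ∀ A' : Site d → Fin d → 𝔸, (∀ y τ, IsSelfAdjoint (A' y τ)) →
      (∀ j, j ≤ c.k → ∀ (y : Site d) (τ : Fin d), SideTouches (c.sq j) y τ →
      W y τ = cfgExp η A' y τ ∧ ‖A' y τ‖ ≤ α₂ * ((L : ℝ) ^ j * η)⁻¹) →
      (∀ (y : Site d) (τ : Fin d), (∀ j, j ≤ c.k → ¬ SideTouches (c.sq j) y τ) → A' y τ = 0) →
      msup L c.k η (-(1 : ℝ)) (fun j (b : Site d × Fin d) => SideTouches (c.sq j) b.1 b.2) (fun b => A' b.1 b.2)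
      ≤ B₀ * (bondNorm L c.k η (-(3 : ℝ)) c.sq (fun x μ => Jcur η (1 : Site d → Fin d → 𝔸ˣ) A' μ x)
      + wsup 1 (fun p : {p : ℕ × (Site d × Fin d) // p.1 ≤ c.k ∧ (p.2 ∈ c.lamBPT c.k p.1 ∨ (p.1 = 0 ∧ CrossB (c.sq 0) p.2))} =>
      linCovIterZ L (1 : Site d → Fin d → 𝔸ˣ) (iEta η A') p.1.1 p.1.2.1 p.1.2.2)) + Bbd * msup L c.k η (-(1 : ℝ))
      (fun j (b : Site d × Fin d) => j = 0 ∧ SideTouches (c.sq 0) b.1 b.2 ∧ ¬ BondTouches (c.sq 0) b.1 b.2)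
      (fun b => A' b.1 b.2) ∧
      msup L c.k η (-(2 : ℝ)) (fun j (t : Fin d × Fin d × Site d) => SideTouches (c.sq j) t.2.2 t.2.1)
      (fun t => covDerivFwd η (1 : Site d → Fin d → 𝔸ˣ) t.1 (fun z => A' z t.2.1) t.2.2)
      ≤ B₀ * (bondNorm L c.k η (-(3 : ℝ)) c.sq (fun x μ => Jcur η (1 : Site d → Fin d → 𝔸ˣ) A' μ x)
      + wsup 1 (fun p : {p : ℕ × (Site d × Fin d) // p.1 ≤ c.k ∧ (p.2 ∈ c.lamBPT c.k p.1 ∨ (p.1 = 0 ∧ CrossB (c.sq 0) p.2))} =>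
      linCovIterZ L (1 : Site d → Fin d → 𝔸ˣ) (iEta η A') p.1.1 p.1.2.1 p.1.2.2)) + Bbd * msup L c.k η (-(1 : ℝ))
      (fun j (b : Site d × Fin d) => j = 0 ∧ SideTouches (c.sq 0) b.1 b.2 ∧ ¬ BondTouches (c.sq 0) b.1 b.2)
      (fun b => A' b.1 b.2) ∧
      bondNorm L c.k η (-(3 : ℝ)) c.sq (fun x μ => pdiv η (1 : Site d → Fin d → 𝔸ˣ) (plaqCovDeriv η (1 : Site d → Fin d → 𝔸ˣ) A') μ x)
      ≤ B₀ * (bondNorm L c.k η (-(3 : ℝ)) c.sq (fun x μ => Jcur η (1 : Site d → Fin d → 𝔸ˣ) A' μ x)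
      + wsup 1 (fun p : {p : ℕ × (Site d × Fin d) // p.1 ≤ c.k ∧ (p.2 ∈ c.lamBPT c.k p.1 ∨ (p.1 = 0 ∧ CrossB (c.sq 0) p.2))} =>
      linCovIterZ L (1 : Site d → Fin d → 𝔸ˣ) (iEta η A') p.1.1 p.1.2.1 p.1.2.2)) + Bbd * msup L c.k η (-(1 : ℝ))
      (fun j (b : Site d × Fin d) => j = 0 ∧ SideTouches (c.sq 0) b.1 b.2 ∧ ¬ BondTouches (c.sq 0) b.1 b.2)
      (fun b => A' b.1 b.2) ∧
      bondNorm L c.k η (-(3 : ℝ)) c.sq (fun x μ => covLap η (1 : Site d → Fin d → 𝔸ˣ) (fun z => A' z μ) x)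
      ≤ B₀ * (bondNorm L c.k η (-(3 : ℝ)) c.sq (fun x μ => Jcur η (1 : Site d → Fin d → 𝔸ˣ) A' μ x)
      + wsup 1 (fun p : {p : ℕ × (Site d × Fin d) // p.1 ≤ c.k ∧ (p.2 ∈ c.lamBPT c.k p.1 ∨ (p.1 = 0 ∧ CrossB (c.sq 0) p.2))} =>
      linCovIterZ L (1 : Site d → Fin d → 𝔸ˣ) (iEta η A') p.1.1 p.1.2.1 p.1.2.2)) + Bbd * msup L c.k η (-(1 : ℝ))
      (fun j (b : Site d × Fin d) => j = 0 ∧ SideTouches (c.sq 0) b.1 b.2 ∧ ¬ BondTouches (c.sq 0) b.1 b.2)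
      (fun b => A' b.1 b.2)) →
      ∀ (U₀ : Site d → Fin d → 𝔸ˣ), (∀ x κ, U₀ x κ ∈ unitaryUnits 𝔸) → ∀ (α₀ : ℝ), 0 < α₀ →
      C0Z d * (α₀ * (L : ℝ) ^ 2) ≤ 1 / 3 → 2 * (α₀ * (L : ℝ) ^ 2) ≤ c2' d L →
      InAk L c.k η α₀ Ω U₀ →
      11 * (d : ℝ) ^ 2 * (L : ℝ) ^ 2 * α₀ + ((c.M : ℝ) + 4 * c.ρ) * d * (L : ℝ) ^ 2 * α₀ ≤ 1 / 6 →
      (L : ℝ) ^ 3 * α₀ ≤ c₀ → 5 * (d : ℝ) * L * B₀ * ((L : ℝ) ^ 3 * α₀ + 6 * d * (L : ℝ) ^ 2 * c.M * α₀) ≤ c₀ →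
      2 * (5 * (d : ℝ) * L * B₀ * ((L : ℝ) ^ 3 * α₀ + 6 * d * (L : ℝ) ^ 2 * c.M * α₀)) ^ 2
        + 20 * d * ((L : ℝ) ^ 3 * α₀) * (5 * (d : ℝ) * L * B₀ * ((L : ℝ) ^ 3 * α₀ + 6 * d * (L : ℝ) ^ 2 * c.M * α₀))
        + 2 * C₂ * (5 * (d : ℝ) * L * B₀ * ((L : ℝ) ^ 3 * α₀ + 6 * d * (L : ℝ) ^ 2 * c.M * α₀)) ^ 2
        ≤ (L : ℝ) ^ 3 * α₀ + 6 * d * (L : ℝ) ^ 2 * c.M * α₀ →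
      (d : ℝ) * L * (6 * d * (L : ℝ) ^ 2 * c.M * α₀) ≤ 1 / 8 →
      ∀ (u : Site d → 𝔸ˣ), (∀ x, u x ∈ unitaryUnits 𝔸) → (∀ x, x ∉ c.sq 0 → u x = 1) →
      Restr129Z L c.k c.lamS (1 : Site d → Fin d → 𝔸ˣ) u →
      IsLandau138WZ L c.k η (c.sq 0) c.lamS (1 : Site d → Fin d → 𝔸ˣ)
        (gaugeAct u⁻¹ (cutFixedZ L (tLo c.a c.ρ) (tHi c.a c.M c.ρ) U₀ c.k (ctr c.a c.M))) →
      (∀ j, j ≤ c.k → ∀ b ∈ {b : Site d × Fin d | SideTouches (c.sq j) b.1 b.2},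
        gaugeAct u⁻¹ (cutFixedZ L (tLo c.a c.ρ) (tHi c.a c.M c.ρ) U₀ c.k (ctr c.a c.M)) b.1 b.2 =
            cfgExp η (logCfg η (gaugeAct u⁻¹ (cutFixedZ L (tLo c.a c.ρ) (tHi c.a c.M c.ρ) U₀ c.k (ctr c.a c.M)))) b.1 b.2 ∧
          IsSelfAdjoint (logCfg η (gaugeAct u⁻¹ (cutFixedZ L (tLo c.a c.ρ) (tHi c.a c.M c.ρ) U₀ c.k (ctr c.a c.M))) b.1 b.2) ∧
          ‖logCfg η (gaugeAct u⁻¹ (cutFixedZ L (tLo c.a c.ρ) (tHi c.a c.M c.ρ) U₀ c.k (ctr c.a c.M))) b.1 b.2‖ ≤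
            (5 * (d : ℝ) * L * B₀ * ((L : ℝ) ^ 3 * α₀ + 6 * d * (L : ℝ) ^ 2 * c.M * α₀)) * ((L : ℝ) ^ j * η)⁻¹) →
      msup L c.k η (-(2 : ℝ)) (fun j (t : Fin d × Fin d × Site d) => SideTouches (c.sq j) t.2.2 t.2.1)
          (fun t => covDerivFwd η (1 : Site d → Fin d → 𝔸ˣ) t.1 (fun z => mlogCfg c.k η c.sq
            (gaugeAct u⁻¹ (cutFixedZ L (tLo c.a c.ρ) (tHi c.a c.M c.ρ) U₀ c.k (ctr c.a c.M))) z t.2.1) t.2.2)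
        ≤ 5 * (d : ℝ) * L * B₀ * ((L : ℝ) ^ 3 * α₀ + 6 * d * (L : ℝ) ^ 2 * c.M * α₀) ∧
      bondNorm L c.k η (-(3 : ℝ)) c.sq (fun x μ => pdiv η (1 : Site d → Fin d → 𝔸ˣ)
          (plaqCovDeriv η (1 : Site d → Fin d → 𝔸ˣ) (mlogCfg c.k η c.sq
            (gaugeAct u⁻¹ (cutFixedZ L (tLo c.a c.ρ) (tHi c.a c.M c.ρ) U₀ c.k (ctr c.a c.M))))) μ x)
        ≤ 5 * (d : ℝ) * L * B₀ * ((L : ℝ) ^ 3 * α₀ + 6 * d * (L : ℝ) ^ 2 * c.M * α₀) ∧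
      bondNorm L c.k η (-(3 : ℝ)) c.sq (fun x μ => covLap η (1 : Site d → Fin d → 𝔸ˣ)
          (fun z => mlogCfg c.k η c.sq (gaugeAct u⁻¹ (cutFixedZ L (tLo c.a c.ρ) (tHi c.a c.M c.ρ) U₀ c.k (ctr c.a c.M))) z μ) x)
        ≤ 5 * (d : ℝ) * L * B₀ * ((L : ℝ) ^ 3 * α₀ + 6 * d * (L : ℝ) ^ 2 * c.M * α₀) := by
  have hL : Odd L := ⟨s, by omega⟩
  have hL2 : 2 ≤ L := by omega
  have hL1 : 1 ≤ L := by omega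
  have hd1 : 1 ≤ d := le_trans (by norm_num) hd2
  obtain ⟨cw, hcw, hwin⟩ := prop3_windowsZ hd1 hL1 hB₀.le
  have hLpos0 : (0 : ℝ) < L := by exact_mod_cast (show 0 < L by omega)
  refine ⟨min cB9 (cw / (L : ℝ) ^ 2), lt_min hcB9 (by positivity), ?_⟩
  intro η hη K Ω c SB9D U₀ hU₀ α₀ hα hα3 hα2 hA hsmall hc₀ hc₂ h61 hsmall₁ u hu huS h129 hLan h162
  have hk : 1 ≤ c.k := c.one_le_k
  have hρL : L ≤ c.ρ := c.L_le_ρ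
  have hρM : c.ρ ≤ c.M := c.ρ_le_M
  have hM : 11 * (d : ℝ) < c.M := by exact_mod_cast c.big
  have hρ : 1 ≤ c.ρ := hL1.trans hρL
  have hM1 : 1 ≤ c.M := hρ.trans hρM
  have hLr : (1 : ℝ) ≤ L := by exact_mod_cast hL1
  have hdpos : (0 : ℝ) < d := by exact_mod_cast hd1
  have hMpos : (0 : ℝ) < c.M := by exact_mod_cast hM1
  have hg0' : 0 ≤ gZ d L := gZ_nonneg d L
  set α₀' : ℝ := (L : ℝ) ^ 3 * α₀ with hα₀'_def
  set α₁' : ℝ := 6 * d * (L : ℝ) ^ 2 * c.M * α₀ with hα₁'_def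
  set α₂ : ℝ := 5 * (d : ℝ) * L * B₀ * ((L : ℝ) ^ 3 * α₀ + 6 * d * (L : ℝ) ^ 2 * c.M * α₀) with hα₂_def
  have hα₀' : 0 < α₀' := by positivity
  have hα₁' : 0 < α₁' := by positivity
  have hα₂ : 0 < α₂ := by positivity
  -- EDITION γ: the record's Prop-4 windows ONE LEVEL LOWER, i.e. Prop. 3's record windows at the scaled pair `(L²α₀′, L·α₂)` (thresholds `≤ c_w ∕ L²`)
  have hL2r : (1 : ℝ) ≤ (L : ℝ) ^ 2 := one_le_pow₀ hLr
  have hL2pos : (0 : ℝ) < (L : ℝ) ^ 2 := by positivity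
  have hcwL : cw / (L : ℝ) ^ 2 ≤ cw / (L : ℝ) := by
    have hLL : (L : ℝ) ≤ (L : ℝ) ^ 2 := by nlinarith [hLr]
    exact div_le_div_of_nonneg_left hcw.le (by positivity) hLL
  have hsc₀ : (L : ℝ) ^ 2 * α₀' ≤ cw := by
    have h := mul_le_mul_of_nonneg_left (hc₀.trans (min_le_right _ _)) hL2pos.le
    rwa [mul_div_cancel₀ _ hL2pos.ne'] at h
  have hsc₂ : (L : ℝ) * α₂ ≤ cw := by
    have h := mul_le_mul_of_nonneg_left ((hc₂.trans (min_le_right _ _)).trans hcwL) hLpos0.le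
    rwa [mul_div_cancel₀ _ hLpos0.ne'] at h
  have hLα₂0 : 0 ≤ (L : ℝ) * α₂ := by positivity
  obtain ⟨hα3', hα4', h16γ, hd5γ, hsm, hc₃, hsideγ, h50γ, hC⟩ :=
    hwin ((L : ℝ) ^ 2 * α₀') ((L : ℝ) * α₂) (by positivity) hsc₀ hLα₂0 hsc₂
  -- the level-`k` windows at `α₂` itself (monotone in `α₂ ≤ L·α₂`)
  have hα₂L : α₂ ≤ (L : ℝ) * α₂ := le_mul_of_one_le_left hα₂.le hLr
  have h16 : 16 * α₂ ≤ 1 := by linarith only [h16γ, hα₂L]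
  have hd5 : 5 * α₂ * ((d : ℝ) - 1) ≤ 4 := by
    have hd1' : (0 : ℝ) ≤ (d : ℝ) - 1 := by linarith only [show (1 : ℝ) ≤ d by exact_mod_cast hd1]
    nlinarith only [hd5γ, hα₂L, hd1', hα₂.le]
  have hside : 36 * d * B₀ * α₂ ≤ 1 / 2 := by
    have h := mul_le_mul_of_nonneg_left hα₂L (by positivity : (0 : ℝ) ≤ 36 * d * B₀)
    linarith only [hsideγ, h]
  have h50 : 50 * d * α₂ ≤ 1 := by
    have h := mul_le_mul_of_nonneg_left hα₂L (by positivity : (0 : ℝ) ≤ 50 * d)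
    linarith only [h50γ, h]
  have hC₂' : (1 + 2 * gZ d L) * (2 * (131072 * ((d : ℝ) + 1) ^ 2) * (KZ d L) ^ 2) * Real.exp (4 * cZ d * ((L : ℝ) ^ 2 * α₀')) * (L : ℝ) ^ 2
      ≤ C₂ := (mul_le_mul_of_nonneg_right hC hL2pos.le).trans hC₂
  set U'' := cutFixedZ L (tLo c.a c.ρ) (tHi c.a c.M c.ρ) U₀ c.k (ctr c.a c.M) with hU''
  obtain ⟨hmem, h33, h34, -, -, -⟩ := thm4_hypotheses_one_cutFixed_dented_γ hLs hs hd1 c U₀ hU₀ hα hα3 hα2 hη hA hsmall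
  have hone : ∀ x κ, (1 : Site d → Fin d → 𝔸ˣ) x κ ∈ unitaryUnits 𝔸 := fun _ _ => (unitaryUnits 𝔸).one_mem
  have hui : ∀ x, u⁻¹ x ∈ U1 𝔸 := fun x => unitaryUnits_le_U1 ((unitaryUnits 𝔸).inv_mem (hu x))
  have hU₁u : ∀ x κ, gaugeAct u⁻¹ U'' x κ ∈ unitaryUnits 𝔸 := gaugeAct_mem_of hmem fun x => (unitaryUnits 𝔸).inv_mem (hu x)
  set W : Site d → Fin d → 𝔸ˣ := gaugeAct u⁻¹ U'' with hW_def
  set A : Site d → Fin d → 𝔸 := mlogCfg c.k η c.sq W with hA_def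
  -- the canonical exponent: Hermitian, (1.41), `W = e^{iηA}` on the `E j`, `0` off them
  obtain ⟨hAsa, hrep, hA0⟩ := mlogCfg_spec hη hL1 c.k (1 : Site d → Fin d → 𝔸ˣ) hU₁u hα₂.le h16 c.sq
    (fun j hj y τ hs => ⟨(h162 j hj (y, τ) hs).1, (h162 j hj (y, τ) hs).2.2⟩)
  have h41 : ∀ j, j ≤ c.k → ∀ (y : Site d) (τ : Fin d), SideTouches (c.sq j) y τ →
      W y τ = cfgExp η A y τ ∧ ‖A y τ‖ ≤ α₂ * ((L : ℝ) ^ j * η)⁻¹ := fun j hj y τ hs =>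
    ⟨(hrep j hj y τ hs).2, by rw [hA_def, (hrep j hj y τ hs).1]; exact (h162 j hj (y, τ) hs).2.2⟩
  have h41' : ∀ j, j ≤ c.k → ∀ (y : Site d) (τ : Fin d), SideTouches (c.sq j) y τ →
      ‖A y τ‖ ≤ α₂ * ((L : ℝ) ^ j * η)⁻¹ := fun j hj y τ hs => (h41 j hj y τ hs).2
  -- (1.40)₂ for `W·1` by gauge invariance from (1.132), and for `e^{iηA}·1` by locality
  have hW₀ : mulCfg U'' (1 : Site d → Fin d → 𝔸ˣ) = U'' := mul_one _
  have hW₁ : mulCfg W (1 : Site d → Fin d → 𝔸ˣ) = W := mul_one _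
  have hPair : InAk L c.k η α₀' c.sq (mulCfg W (1 : Site d → Fin d → 𝔸ˣ)) := by
    rw [hW₁, hW_def, inAk_gaugeAct_iff L c.k η _ _ hui]
    rw [hW₀] at h34
    exact h34
  have h40₁ : InAk L c.k η α₀' c.sq (mulCfg (expCfg (iEta η A)) (1 : Site d → Fin d → 𝔸ˣ)) := by
    refine (inAk_congr_of_sideTouches L c.k η α₀' (V := mulCfg W (1 : Site d → Fin d → 𝔸ˣ)) fun j hj y τ hs => ?_).1 hPair
    show W y τ * (1 : Site d → Fin d → 𝔸ˣ) y τ = expCfg (iEta η A) y τ * (1 : Site d → Fin d → 𝔸ˣ) y τ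
    rw [(h41 j hj y τ hs).1, expCfg_iEta_eq_cfgExp]
  have hAglob : ∀ y τ, ‖A y τ‖ ≤ α₂ * η⁻¹ := by
    intro y τ
    by_cases hmem' : ∃ j, j ≤ c.k ∧ SideTouches (c.sq j) y τ
    · obtain ⟨j, hj, hs'⟩ := hmem'
      have hLj : (1 : ℝ) ≤ (L : ℝ) ^ j := one_le_pow₀ hLr
      calc ‖A y τ‖ ≤ α₂ * ((L : ℝ) ^ j * η)⁻¹ := h41' j hj y τ hs'
        _ = α₂ * η⁻¹ * ((L : ℝ) ^ j)⁻¹ := by rw [mul_inv]; ring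
        _ ≤ α₂ * η⁻¹ * 1 := by
            apply mul_le_mul_of_nonneg_left (inv_le_one_of_one_le₀ hLj) (by positivity)
        _ = α₂ * η⁻¹ := mul_one _
    · rw [hA_def, hA0 y τ fun j hj hs' => hmem' ⟨j, hj, hs'⟩, norm_zero]
      positivity
  have hgrad : ∀ (y : Site d) (κ τ : Fin d), ‖covDerivFwd η (1 : Site d → Fin d → 𝔸ˣ) κ (fun z => A z τ) y‖ ≤ 2 * α₂ * η⁻¹ * η⁻¹ := by
    intro y κ τ
    unfold covDerivFwd
    rw [norm_smul, norm_inv, Real.norm_eq_abs, abs_of_pos hη]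
    have h1 : ‖B7Eq78Linearization.conjR ((1 : Site d → Fin d → 𝔸ˣ) y κ) (A (y + e κ) τ) - A y τ‖ ≤ α₂ * η⁻¹ + α₂ * η⁻¹ := by
      calc ‖B7Eq78Linearization.conjR ((1 : Site d → Fin d → 𝔸ˣ) y κ) (A (y + e κ) τ) - A y τ‖
          ≤ ‖B7Eq78Linearization.conjR ((1 : Site d → Fin d → 𝔸ˣ) y κ) (A (y + e κ) τ)‖ + ‖A y τ‖ := norm_sub_le _ _
        _ ≤ α₂ * η⁻¹ + α₂ * η⁻¹ := by
            rw [B8Ineq132.norm_conjR (unitaryUnits_le_U1 (hone y κ))]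
            exact add_le_add (hAglob _ _) (hAglob _ _)
    calc η⁻¹ * ‖B7Eq78Linearization.conjR ((1 : Site d → Fin d → 𝔸ˣ) y κ) (A (y + e κ) τ) - A y τ‖ ≤ η⁻¹ * (α₂ * η⁻¹ + α₂ * η⁻¹) :=
        mul_le_mul_of_nonneg_left h1 (by positivity)
      _ = 2 * α₂ * η⁻¹ * η⁻¹ := by ring
  have hBg : Bdd L c.k η (-(2 : ℝ)) (fun j (t : Fin d × Fin d × Site d) => SideTouches (c.sq j) t.2.2 t.2.1)
      (fun t => covDerivFwd η (1 : Site d → Fin d → 𝔸ˣ) t.1 (fun z => A z t.2.1) t.2.2) := by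
    have e2 : (-(2 : ℝ)) = -((2 : ℕ) : ℝ) := by norm_num
    rw [e2]
    refine B8ScaledSupNorm.bdd_of_forall (c := 2 * α₂ * ((L : ℝ) ^ c.k) ^ 2) fun j hj t _ => ?_
    rw [B8ScaledSupNorm.weight_neg_natCast L η 2 j]
    have hLjk : (L : ℝ) ^ j ≤ (L : ℝ) ^ c.k := pow_le_pow_right₀ hLr hj
    have hLj0 : (0 : ℝ) ≤ (L : ℝ) ^ j := by positivity
    calc ((L : ℝ) ^ j * η) ^ 2 * ‖covDerivFwd η (1 : Site d → Fin d → 𝔸ˣ) t.1 (fun z => A z t.2.1) t.2.2‖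
        ≤ ((L : ℝ) ^ j * η) ^ 2 * (2 * α₂ * η⁻¹ * η⁻¹) := mul_le_mul_of_nonneg_left (hgrad _ _ _) (by positivity)
      _ = 2 * α₂ * ((L : ℝ) ^ j) ^ 2 := by field_simp
      _ ≤ 2 * α₂ * ((L : ℝ) ^ c.k) ^ 2 := by gcongr
  set g : ℝ := msup L c.k η (-(2 : ℝ)) (fun j (t : Fin d × Fin d × Site d) => SideTouches (c.sq j) t.2.2 t.2.1)
      (fun t => covDerivFwd η (1 : Site d → Fin d → 𝔸ˣ) t.1 (fun z => A z t.2.1) t.2.2) with hg_def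
  have hg0 : 0 ≤ g := B8ScaledSupNorm.msup_nonneg L c.k hη.le _ _ _
  have hg : ∀ j, j ≤ c.k → ∀ (y : Site d) (κ τ : Fin d), SideTouches (c.sq j) y τ →
      ((L : ℝ) ^ j * η) ^ 2 * ‖covDerivFwd η (1 : Site d → Fin d → 𝔸ˣ) κ (fun z => A z τ) y‖ ≤ g := by
    intro j hj y κ τ hs'
    have h := B8ScaledSupNorm.weight_mul_norm_le_msup hBg hj (i := (κ, τ, y)) hs'
    have hw : weight L η (-(2 : ℝ)) j = ((L : ℝ) ^ j * η) ^ 2 := by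
      have e2 : (-(2 : ℝ)) = -((2 : ℕ) : ℝ) := by norm_num
      rw [e2, B8ScaledSupNorm.weight_neg_natCast L η 2 j]
    rw [hw] at h
    exact h
  -- the in-edge (1.59), four lines, from the FLAT β socket AT THE MEMBER
  obtain ⟨h59a, h59g, h59j, h59l⟩ := SB9D α₀' α₂ hα₀' (hc₀.trans (min_le_left _ _)) hα₂ (hc₂.trans (min_le_left _ _))
    W hU₁u h33 hPair hLan A hAsa h41 hA0
  -- (1.42)₂ at ALL levels on the split print class — inner AND crossing bonds — (`c137_dentedMember_γ`, record) and its γ box law (CENTRED boxes)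
  have h42 := c137_dentedMember_γ hd2 hLs hs c U₀ hU₀ hα hα3 hα2 hη hA hsmall hα₂.le hα3' hα4' h16 hsm hc₃ hsmall₁ u hu h129 h162
  have hbox : ∀ j, j ≤ c.k → ∀ b ∈ c.lamBPT c.k j, ∀ x,
      InBox (fun i => (L : ℤ) ^ j * b.1 i - (ctrShift L j : ℤ)) (fun i => (L : ℤ) ^ j * b.1 i + (ctrShift L j : ℤ) + if i = b.2 then (L : ℤ) ^ j else 0) x →
      x ∈ c.sq (j - 1) :=
    fun j hj b hb x hx => lamBPT_hbox_pred c hLs c.k le_rfl j hj b hb x hx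
  -- `u = 1` AT EVERY SITE OF `□₀` WITH A NEIGHBOUR (sup-distance ≤ 2) OUTSIDE `□₀`: such a site is not in `□₁` (margin of (1.131), centred), hence lies in
  -- `Λ₀ = □₀ ∖ □₁ ⊆ Λ′₀`, where (1.29) at level 0 pins `u = 1`
  have hM2 := margin2_cubeFamZ hL c.a c.M (hL2.trans hρL) c.k
  have hlayer : ∀ y z : Site d, y ∈ c.sq 0 → z ∉ c.sq 0 →
      (∀ i, y i - 2 ≤ z i ∧ z i ≤ y i + 2) → u y = 1 := by
    intro y z hy hz hyz
    have hz' : z ∉ cubeFamZ false L c.a c.M c.ρ c.k 0 := by rw [cubeFam_false_zero, ← c.sq_zero]; exact hz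
    have hy1 : y ∉ cubeFamZ false L c.a c.M c.ρ c.k 1 := fun h1 => hz' (hM2 1 le_rfl y h1 z hyz)
    have hyS : y ∈ c.lamS 0 := mem_lamS_zero_of_not_mem_cube_one c hL hy hy1
    exact Units.val_eq_one.mp (restr129Z_level_zero h129 hyS)
  -- ON A TOUCHING SIDE OF `□₀` NOT HAVING BOTH END-POINTS IN `□₀` (an outer side, or a CROSSING bond): `u = 1` at both end-points, so `W = U₀″`
  -- there and `η‖A‖ = ‖log U₀″‖ ≤ 2‖U₀″ − 1‖ ≤ 2·6dL²Mα₀` by (1.133)₀ read on every bond (`norm_cutFixedZ_sub_one_le`)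
  have hcol : ∀ b : Site d × Fin d, SideTouches (c.sq 0) b.1 b.2 →
      ¬ (b.1 ∈ c.sq 0 ∧ b.1 + e b.2 ∈ c.sq 0) → η * ‖A b.1 b.2‖ ≤ 2 * α₁' := by
    intro b hsd hnb
    have he1 : ∀ i, b.1 i - 2 ≤ (b.1 + e b.2) i ∧ (b.1 + e b.2) i ≤ b.1 i + 2 := by
      intro i
      simp only [Pi.add_apply, e_apply]
      split_ifs <;> constructor <;> omega
    have he2 : ∀ i, (b.1 + e b.2) i - 2 ≤ b.1 i ∧ b.1 i ≤ (b.1 + e b.2) i + 2 := by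
      intro i
      simp only [Pi.add_apply, e_apply]
      split_ifs <;> constructor <;> omega
    have hx : u b.1 = 1 := by
      by_cases h : b.1 ∈ c.sq 0
      · exact hlayer b.1 (b.1 + e b.2) h (fun h' => hnb ⟨h, h'⟩) he1
      · exact huS _ h
    have hxe : u (b.1 + e b.2) = 1 := by
      by_cases h : b.1 + e b.2 ∈ c.sq 0
      · exact hlayer (b.1 + e b.2) b.1 h (fun h' => hnb ⟨h', h⟩) he2
      · exact huS _ h
    have hWb : W b.1 b.2 = U'' b.1 b.2 := by
      show gaugeAct u⁻¹ U'' b.1 b.2 = U'' b.1 b.2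
      simp only [gaugeAct, Pi.inv_apply, hx, hxe, inv_one, one_mul, mul_one]
    have hAb : A b.1 b.2 = logCfg η W b.1 b.2 := mlogCfg_of_sideTouches η W (Nat.zero_le c.k) hsd
    have hUb : ‖((U'' b.1 b.2 : 𝔸ˣ) : 𝔸) - 1‖ ≤ α₁' :=
      norm_cutFixedZ_sub_one_le hLs hL2 hd1 (avgClosedZ_unitaryUnits (𝔸 := 𝔸) d L) c.k U₀ hU₀ hα hα3 hα2 c.a hρ hρM hM hA c.tcube_sub hsmall b.1 b.2
    have hU1 : ‖((U'' b.1 b.2 : 𝔸ˣ) : 𝔸) - 1‖ ≤ 1 / 2 := hUb.trans (by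
      have hdL1 : (1 : ℝ) ≤ (d : ℝ) * L := one_le_mul_of_one_le_of_one_le (by exact_mod_cast hd1) hLr
      have h1 : α₁' ≤ (d : ℝ) * L * α₁' := le_mul_of_one_le_left hα₁'.le hdL1
      linarith [hsmall₁])
    rw [hAb, logCfg, hWb, norm_smul, norm_smul, norm_inv, norm_inv, Complex.norm_I, inv_one, one_mul, Real.norm_eq_abs,
      abs_of_pos hη, ← mul_assoc, mul_inv_cancel₀ hη.ne', one_mul]
    exact (MatrixLog.norm_mlog_le_two_mul hU1).trans (by linarith [hUb])
  -- THE COLLAR TERM `Φ₀(A′)` (outer sides: both end-points outside `□₀`) `≤ 2α₁′`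
  set Φ₀ : ℝ := msup L c.k η (-(1 : ℝ))
      (fun j (b : Site d × Fin d) => j = 0 ∧ SideTouches (c.sq 0) b.1 b.2 ∧ ¬ BondTouches (c.sq 0) b.1 b.2)
      (fun b => A b.1 b.2) with hΦ₀_def
  have hΦ₀ : Φ₀ ≤ 2 * α₁' := by
    refine B8ScaledSupNorm.msup_le (by positivity) fun j hj b hb => ?_
    obtain ⟨rfl, hsd, hnb⟩ := hb
    have e1 : (-(1 : ℝ)) = -((1 : ℕ) : ℝ) := by norm_num
    rw [e1, B8ScaledSupNorm.weight_neg_natCast L η 1 0, pow_one, pow_zero, one_mul]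
    exact hcol b hsd fun h => hnb (Or.inl h.1)
  have hΦ₀0 : 0 ≤ Φ₀ := B8ScaledSupNorm.msup_nonneg L c.k hη.le _ _ _
  -- the window: `2·Bbd·Φ₀ ≤ 4·Bbd·α₁′ ≤ (dL − 1)B₀(α₀′ + α₁′)`
  have hβ : Bbd * Φ₀ + Bbd * Φ₀ ≤ ((d : ℝ) * L - 1) * B₀ * (α₀' + α₁') := by
    have h1 : Bbd * Φ₀ + Bbd * Φ₀ ≤ 4 * Bbd * α₁' := by
      have h := mul_le_mul_of_nonneg_left hΦ₀ hBbd
      linarith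
    have h2 : 4 * Bbd * α₁' ≤ ((d : ℝ) * L - 1) * B₀ * α₁' := mul_le_mul_of_nonneg_right hBd hα₁'.le
    have h3 : 0 ≤ ((d : ℝ) * L - 1) * B₀ := le_trans (by positivity) hBd
    have h4 : ((d : ℝ) * L - 1) * B₀ * α₁' ≤ ((d : ℝ) * L - 1) * B₀ * (α₀' + α₁') :=
      mul_le_mul_of_nonneg_left (le_add_of_nonneg_left hα₀'.le) h3
    linarith
  -- PROPOSITION 3 at `k` levels with the allowances (`B8Prop3KLevelBdry`), then the slack absorbs them
  have h₀ : ∀ y κ, (1 : Site d → Fin d → 𝔸ˣ) y κ ∈ U1 𝔸 := fun y κ => unitaryUnits_le_U1 (hone y κ)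
  have h55 := B8Eq155KLevelLocal.eq155_norm_kLevel_hermitian hη hL1 h₀ hAsa hα₀'.le hα₂.le h16 hd5 hg0 h33 h40₁ h41' hg
  have h41'' : ∀ j, j ≤ c.k → ∀ x μ, BondTouches (c.sq j) x μ → ‖A x μ‖ ≤ α₂ * ((L : ℝ) ^ j * η)⁻¹ :=
    fun j hj x μ hb => B8Prop3KLevel.bound_of_sideTouches hd2 (h41' j hj) x μ hb
  -- «|B₁|β < 2dLα₁ + C₂α₂²»: on the constraint bonds by (1.42)₂ + (1.37) (`norm_B1_lt_kLevel_γ`, record); on a level-0 CROSSING bond `Q₀ = 1`, the term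
  -- is `η‖A′(b)‖ ≤ 2α₁′ ≤ 2dLα₁′` (`hcol`)
  have hdL : (1 : ℝ) ≤ (d : ℝ) * L := one_le_mul_of_one_le_of_one_le (by exact_mod_cast hd1) hLr
  have hGpos : (0 : ℝ) ≤ (1 + 2 * gZ d L) * (2 * (131072 * ((d : ℝ) + 1) ^ 2) * (KZ d L) ^ 2) := by positivity
  have hC0 : 0 ≤ (1 + 2 * gZ d L) * (2 * (131072 * ((d : ℝ) + 1) ^ 2) * (KZ d L) ^ 2) * Real.exp (4 * cZ d * ((L : ℝ) ^ 2 * α₀'))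
      * (L : ℝ) ^ 2 * α₂ ^ 2 := by
    positivity
  haveI : Nontrivial (Fin d) := Fin.nontrivial_iff_two_le.mpr hd2
  obtain ⟨-, hg', hj', hl'⟩ := B8Prop3KLevelBdry.apriori_160_bdry (L := (L : ℝ)) (B₀ := B₀) (α₁ := α₁')
    (C₂ := (1 + 2 * gZ d L) * (2 * (131072 * ((d : ℝ) + 1) ^ 2) * (KZ d L) ^ 2) * Real.exp (4 * cZ d * ((L : ℝ) ^ 2 * α₀')) * (L : ℝ) ^ 2)
    (Nat.cast_nonneg d) hB₀.le hα₂.le hg0 h55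
    (by
      refine B8Eq155JBound.wsup_le (fun p => ?_) (by positivity)
      obtain ⟨⟨j, b⟩, hj, hc | ⟨hj0, hcr⟩⟩ := p
      · have hj' : j ≤ c.k := hj
        have hc' : b ∈ c.lamBPT c.k j := hc
        show 1 * ‖linCovIterZ L (1 : Site d → Fin d → 𝔸ˣ) (iEta η A) j b.1 b.2‖ ≤ _
        rw [one_mul]
        exact (norm_B1_lt_kLevel_γ hη hLs hs hd1 (avgClosedZ_unitaryUnits d L) (1 : Site d → Fin d → 𝔸ˣ) hone hα₀' hα3'
          hα4' A hα₂.le hsm hc₃ hbox h33 h41'' h42 hj' hc').le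
      · have hj0' : j = 0 := hj0
        subst hj0'
        have hbt' : BondTouches (c.sq 0) b.1 b.2 := hcr.1
        have hnb' : ¬ (b.1 ∈ c.sq 0 ∧ b.1 + e b.2 ∈ c.sq 0) := hcr.2
        show 1 * ‖linCovIterZ L (1 : Site d → Fin d → 𝔸ˣ) (iEta η A) 0 b.1 b.2‖ ≤ _
        rw [one_mul, B7SectEFLinearisationRec.linCovIterZ_zero, B8Eq154Local.norm_iEta_apply hη.le]
        obtain ⟨κ, hκ⟩ := exists_ne b.2
        have hsd : SideTouches (c.sq 0) b.1 b.2 := B8Eq140Level.sideTouches_of_bondTouches hκ hbt'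
        have h1 : 2 * α₁' ≤ 2 * d * L * α₁' := by
          have h := mul_le_mul_of_nonneg_right hdL (by positivity : (0 : ℝ) ≤ 2 * α₁')
          linarith [h]
        linarith [hcol b hsd hnb', h1, hC0])
    h59a h59g h59j h59l hside h50
  have hK : 2 * ((1 + 2 * gZ d L) * (2 * (131072 * ((d : ℝ) + 1) ^ 2) * (KZ d L) ^ 2) * Real.exp (4 * cZ d * ((L : ℝ) ^ 2 * α₀')) * (L : ℝ) ^ 2)
      * α₂ ^ 2 ≤ 2 * C₂ * α₂ ^ 2 := by
    have h := mul_le_mul_of_nonneg_right hC₂' (sq_nonneg α₂)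
    linarith
  have hR : B₀ * (4 * α₀' + 4 * d * L * α₁' + 2 * α₂ ^ 2 + 20 * d * α₀' * α₂
      + 2 * ((1 + 2 * gZ d L) * (2 * (131072 * ((d : ℝ) + 1) ^ 2) * (KZ d L) ^ 2) * Real.exp (4 * cZ d * ((L : ℝ) ^ 2 * α₀')) * (L : ℝ) ^ 2)
        * α₂ ^ 2)
      ≤ B₀ * (4 * α₀' + 4 * d * L * α₁' + 2 * α₂ ^ 2 + 20 * d * α₀' * α₂ + 2 * C₂ * α₂ ^ 2) :=
    mul_le_mul_of_nonneg_left (by linarith [hK]) hB₀.le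
  have h162' := B8Prop3KLevelBdry.apriori_162_bdry (C₂ := C₂) (α₂ := α₂) hB₀.le hdL hα₀'.le h61 hβ
  have e5 : 5 * (d : ℝ) * L * B₀ * (α₀' + α₁') = α₂ := by simp only [hα₀'_def, hα₁'_def, hα₂_def]
  refine ⟨?_, ?_, ?_⟩
  · linarith [hg', hR, h162', e5]
  · linarith [hj', hR, h162', e5]
  · linarith [hl', hR, h162', e5]

end Literature.MathematicalPhysics.QuantumFieldTheory.Balaban1983to89.B8Prop6DentedCubeMemberNormsFlatGammaRec

end
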